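import Mathlib
import HarnessLib
import Literature.Analysis.FluidPDE.SuitableWeak
import Literature.Analysis.FluidPDE.SelfSimilar
import Literature.Analysis.FluidPDE.LocalTypeI
import Literature.Analysis.FluidPDE.Seregin2020SingularSetAxis

/-!
# Rotation invariance of the Albritton–Barker quantity `𝐈`, of the Type-I bound and of the
# origin singularity under a linear isometry (helper for `RellichScar.SimilarityCovariance`)

Let `R` be a linear isometry of physical space (a rotation `R_θ` of `ℝ³` about the `x₃`-axis in
the application) and `Ψ(t, x) = (t, R⁻¹ x)` the induced measure-preserving map of space–time.
For the conjugated triple `v = R u(t, R⁻¹x)`, `q = p(t, R⁻¹x)`, `H = R ∘ G(t, R⁻¹x) ∘ R⁻¹`: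

* `abScaledSum_conj` — `(A + C + D + E)(v, q, H; Q((t₀, x₀), r)) = (A + C + D + E)(u, p, G;
  Q((t₀, R⁻¹x₀), r))`: `Ψ` maps the parabolic ball `Q((t₀, x₀), r)` onto `Q((t₀, R⁻¹ x₀), r)`,
  `|R a| = |a|`, `|R ∘ L ∘ R⁻¹|² = |L|²`, and ball averages are transported;
* `typeIBound_lowerHalf_conj` — hence Albritton–Barker's `𝐈(ℝ³ × ℝ₋)` (A–B 2019, §1) is
  rotation invariant (the admissible balls are permuted);
* `isBackwardSingularPoint_zero_conj` — `‖v‖_{L^∞(Q(0, r))} = ‖u‖_{L^∞(Q(0, r))}`, so the origin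
  stays a backward singular point;
* `hasTypeIDecay_conj` — the space–time Type-I bound `|u| ≤ C/(|x| + √−t)` (KNSS 2009, (1.6))
  passes to `v` with the same `C` (`|R⁻¹ x| = |x|`).

The lemmas on `C`, `E`, balls and the Type-I bound are stated for a general finite-dimensional
inner product space `E`; those on `A`, `D`, `𝐈` and singular points for `ℝ³`, where the tree
defines these quantities.

Sources: D. Albritton, T. Barker, JMFM 21 (2019), §1 and §3 ("by translating in space-time and
rescaling" — the same elementary invariances); G. Koch, N. Nadirashvili, G. Seregin, V. Šverák,
Acta Math. 203 (2009), §1.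
-/

-- the summit and its single sub-problem share the name (CONVENTIONS §1), as in every Theorems file
set_option linter.dupNamespace false

namespace Summit.NavierStokesRegularity.NavierStokesRegularity.Theorems.RellichScarSimilarityCovariance

namespace LIE

open MeasureTheory Set Function Metric Filter TopologicalSpace
open scoped ENNReal NNReal InnerProductSpace RealInnerProductSpace
open Literature.Analysis Literature.Analysis.FluidPDE

section General

variable {E : Type*} [NormedAddCommGroup E] [InnerProductSpace ℝ E] [FiniteDimensional ℝ E]
  [MeasurableSpace E] [BorelSpace E] (R : E ≃ₗᵢ[ℝ] E)

omit [FiniteDimensional ℝ E] [MeasurableSpace E] [BorelSpace E] in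
/-- `Ψ(t, x) = (t, R⁻¹ x)` maps the parabolic ball `Q(z, r)` onto `Q((t₀, R⁻¹ x₀), r)`:
preimage form. -/
theorem preimage_prodMap_parabolicCylinder (r : ℝ) (z : ℝ × E) :
    Prod.map (id : ℝ → ℝ) R.symm ⁻¹' parabolicCylinder r (z.1, R.symm z.2) =
      parabolicCylinder r z := by
  ext w
  simp only [mem_preimage, mem_parabolicCylinder, Prod.map_fst, id_eq, Prod.map_snd,
    LinearIsometryEquiv.dist_map]

/-- Change of variables along `Ψ` on a parabolic ball:
`∫⁻_{Q(z, r)} F(Ψ w) dw = ∫⁻_{Q((t₀, R⁻¹x₀), r)} F`. -/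
theorem setLIntegral_parabolicCylinder_comp_prodMap (r : ℝ) (z : ℝ × E) (F : ℝ × E → ℝ≥0∞) :
    ∫⁻ w in parabolicCylinder r z, F (Prod.map (id : ℝ → ℝ) R.symm w) =
      ∫⁻ w in parabolicCylinder r (z.1, R.symm z.2), F w := by
  rw [← preimage_prodMap_parabolicCylinder R r z]
  exact (measurePreserving_prodMap_id_linearIsometryEquiv R.symm).setLIntegral_comp_preimage_emb
    (measurableEmbedding_prodMap_id_linearIsometryEquiv R.symm) F _

/-- **Rotation invariance of `C`**: `C(v; Q(z, r)) = C(u; Q((t₀, R⁻¹x₀), r))`. -/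
theorem cknC_conj (r : ℝ) (z : ℝ × E) (u : ℝ → E → E) :
    cknC r z (fun t x => R (u t (R.symm x))) = cknC r (z.1, R.symm z.2) u := by
  unfold cknC
  rw [← setLIntegral_parabolicCylinder_comp_prodMap R r z (fun w => ‖u w.1 w.2‖ₑ ^ (3 : ℕ))]
  simp only [Prod.map_fst, id_eq, Prod.map_snd, LinearIsometryEquiv.enorm_map]

/-- **Rotation invariance of `E`**: `E(H; Q(z, r)) = E(G; Q((t₀, R⁻¹x₀), r))`
(`|R ∘ L ∘ R⁻¹|² = |L|²`). -/
theorem cknE_conj (r : ℝ) (z : ℝ × E) (G : ℝ → E → E →L[ℝ] E) :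
    cknE r z (fun t x => (R : E →L[ℝ] E).comp ((G t (R.symm x)).comp (R.symm : E →L[ℝ] E))) =
      cknE r (z.1, R.symm z.2) G := by
  unfold cknE
  rw [← setLIntegral_parabolicCylinder_comp_prodMap R r z
    (fun w => ENNReal.ofReal (frobeniusNormSq (G w.1 w.2)))]
  simp only [Prod.map_fst, id_eq, Prod.map_snd, frobeniusNormSq_conj_linearIsometryEquiv]

/-- The spatial `L²`-mass over a ball is transported by `R`:
`∫_{B(x₀, r)} F(R⁻¹ x) dx = ∫_{B(R⁻¹x₀, r)} F(y) dy`. -/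
theorem setLIntegral_ball_comp_symm (r : ℝ) (x₀ : E) (F : E → ℝ≥0∞) :
    ∫⁻ x in ball x₀ r, F (R.symm x) = ∫⁻ y in ball (R.symm x₀) r, F y := by
  have h1 : R.symm ⁻¹' ball (R.symm x₀) r = ball x₀ r := by
    rw [LinearIsometryEquiv.preimage_ball, LinearIsometryEquiv.symm_symm,
      LinearIsometryEquiv.apply_symm_apply]
  rw [← h1]
  exact R.symm.measurePreserving.setLIntegral_comp_preimage_emb
    R.symm.toHomeomorph.measurableEmbedding F _

/-- Ball averages are transported by `R`: `⨍_{B(x₀, r)} f(R⁻¹ x) dx = ⨍_{B(R⁻¹x₀, r)} f`. -/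
theorem setAverage_ball_comp_symm (r : ℝ) (x₀ : E) (f : E → ℝ) :
    ⨍ x in ball x₀ r, f (R.symm x) = ⨍ y in ball (R.symm x₀) r, f y := by
  have h1 : R.symm ⁻¹' ball (R.symm x₀) r = ball x₀ r := by
    rw [LinearIsometryEquiv.preimage_ball, LinearIsometryEquiv.symm_symm,
      LinearIsometryEquiv.apply_symm_apply]
  rw [setAverage_eq, setAverage_eq, measureReal_def, measureReal_def,
    Measure.addHaar_ball_center volume x₀, Measure.addHaar_ball_center volume (R.symm x₀)]
  congr 1
  rw [← h1]
  exact R.symm.measurePreserving.setIntegral_preimage_emb R.symm.toHomeomorph.measurableEmbedding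
    f _

omit [FiniteDimensional ℝ E] [MeasurableSpace E] [BorelSpace E] in
/-- **The space–time Type-I bound is rotation invariant** (KNSS 2009, (1.6)): `|R u(t, R⁻¹x)| =
|u(t, R⁻¹x)| ≤ C/(|R⁻¹x| + √−t) = C/(|x| + √−t)`. -/
theorem hasTypeIDecay_conj {C : ℝ} {u : ℝ → E → E} (h : HasTypeIDecay C u) :
    HasTypeIDecay C (fun t x => R (u t (R.symm x))) := by
  intro t ht x
  have := h t ht (R.symm x)
  rw [LinearIsometryEquiv.norm_map] at this
  rw [LinearIsometryEquiv.norm_map]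
  exact this

end General

section R3

variable (R : EuclideanSpace ℝ (Fin 3) ≃ₗᵢ[ℝ] EuclideanSpace ℝ (Fin 3))
  {u : ℝ → EuclideanSpace ℝ (Fin 3) → EuclideanSpace ℝ (Fin 3)}
  {p : ℝ → EuclideanSpace ℝ (Fin 3) → ℝ}
  {G : ℝ → EuclideanSpace ℝ (Fin 3) → EuclideanSpace ℝ (Fin 3) →L[ℝ] EuclideanSpace ℝ (Fin 3)}

/-- **Rotation invariance of `A`** (essential-supremum form):
`A(v; Q(z, r)) = A(u; Q((t₀, R⁻¹x₀), r))`. -/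
theorem cknAEss_conj (r : ℝ) (z : ℝ × EuclideanSpace ℝ (Fin 3))
    (u : ℝ → EuclideanSpace ℝ (Fin 3) → EuclideanSpace ℝ (Fin 3)) :
    cknAEss r z (fun t x => R (u t (R.symm x))) = cknAEss r (z.1, R.symm z.2) u := by
  unfold cknAEss
  congr 1
  funext t
  simp only [LinearIsometryEquiv.enorm_map]
  rw [setLIntegral_ball_comp_symm R r z.2 (fun y => ‖u t y‖ₑ ^ 2)]

/-- **Rotation invariance of `D`** (mean-free pressure):
`D(q; Q(z, r)) = D(p; Q((t₀, R⁻¹x₀), r))`. -/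
theorem cknDOsc_conj (r : ℝ) (z : ℝ × EuclideanSpace ℝ (Fin 3))
    (p : ℝ → EuclideanSpace ℝ (Fin 3) → ℝ) :
    cknDOsc r z (fun t x => p t (R.symm x)) = cknDOsc r (z.1, R.symm z.2) p := by
  unfold cknDOsc
  rw [← setLIntegral_parabolicCylinder_comp_prodMap R r z
    (fun w => ‖p w.1 w.2 - ⨍ y in ball (R.symm z.2) r, p w.1 y‖ₑ ^ (3 / 2 : ℝ))]
  simp only [Prod.map_fst, id_eq, Prod.map_snd, setAverage_ball_comp_symm]

/-- **Rotation invariance of `A + C + D + E`** on corresponding parabolic balls. -/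
theorem abScaledSum_conj (r : ℝ) (z : ℝ × EuclideanSpace ℝ (Fin 3))
    (u : ℝ → EuclideanSpace ℝ (Fin 3) → EuclideanSpace ℝ (Fin 3))
    (p : ℝ → EuclideanSpace ℝ (Fin 3) → ℝ)
    (G : ℝ → EuclideanSpace ℝ (Fin 3) → EuclideanSpace ℝ (Fin 3) →L[ℝ] EuclideanSpace ℝ (Fin 3)) :
    abScaledSum r z (fun t x => R (u t (R.symm x))) (fun t x => p t (R.symm x))
        (fun t x => (R : EuclideanSpace ℝ (Fin 3) →L[ℝ] EuclideanSpace ℝ (Fin 3)).comp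
          ((G t (R.symm x)).comp
            (R.symm : EuclideanSpace ℝ (Fin 3) →L[ℝ] EuclideanSpace ℝ (Fin 3)))) =
      abScaledSum r (z.1, R.symm z.2) u p G := by
  simp only [abScaledSum, cknAEss_conj, cknC_conj, cknDOsc_conj, cknE_conj]

omit R in
/-- Admissibility in the lower half space only depends on the time centre: if
`Q((t₀, x₀), r) ⊆ ℝ³ × ℝ₋` and `r > 0` then `Q((t₀, x₁), r) ⊆ ℝ³ × ℝ₋`. -/
theorem parabolicCylinder_subset_lowerHalf_of {r : ℝ} (hr : 0 < r) {t₀ : ℝ}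
    {x₀ : EuclideanSpace ℝ (Fin 3)}
    (h : parabolicCylinder r ((t₀, x₀) : ℝ × EuclideanSpace ℝ (Fin 3)) ⊆
      Iio (0 : ℝ) ×ˢ (univ : Set (EuclideanSpace ℝ (Fin 3))))
    (x₁ : EuclideanSpace ℝ (Fin 3)) :
    parabolicCylinder r ((t₀, x₁) : ℝ × EuclideanSpace ℝ (Fin 3)) ⊆
      Iio (0 : ℝ) ×ˢ (univ : Set (EuclideanSpace ℝ (Fin 3))) := by
  intro w hw
  rw [mem_parabolicCylinder] at hw
  have hw' : ((w.1, x₀) : ℝ × EuclideanSpace ℝ (Fin 3)) ∈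
      parabolicCylinder r ((t₀, x₀) : ℝ × EuclideanSpace ℝ (Fin 3)) := by
    rw [mem_parabolicCylinder]
    exact ⟨hw.1, by simpa using hr⟩
  have := h hw'
  simp only [mem_prod, mem_Iio, mem_univ, and_true] at this ⊢
  exact this

/-- **Rotation invariance of `𝐈(ℝ³ × ℝ₋)`** (Albritton–Barker 2019, §1): the Type-I quantity of
the conjugated triple over the lower half space equals that of `(u, p, G)`. -/
theorem typeIBound_lowerHalf_conj
    (u : ℝ → EuclideanSpace ℝ (Fin 3) → EuclideanSpace ℝ (Fin 3))
    (p : ℝ → EuclideanSpace ℝ (Fin 3) → ℝ)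
    (G : ℝ → EuclideanSpace ℝ (Fin 3) → EuclideanSpace ℝ (Fin 3) →L[ℝ] EuclideanSpace ℝ (Fin 3)) :
    typeIBound (Iio (0 : ℝ) ×ˢ univ) (fun t x => R (u t (R.symm x))) (fun t x => p t (R.symm x))
        (fun t x => (R : EuclideanSpace ℝ (Fin 3) →L[ℝ] EuclideanSpace ℝ (Fin 3)).comp
          ((G t (R.symm x)).comp
            (R.symm : EuclideanSpace ℝ (Fin 3) →L[ℝ] EuclideanSpace ℝ (Fin 3)))) =
      typeIBound (Iio (0 : ℝ) ×ˢ univ) u p G := by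
  refine le_antisymm (typeIBound_le_iff.2 fun r hr z hz => ?_)
    (typeIBound_le_iff.2 fun r hr z hz => ?_)
  · rw [abScaledSum_conj]
    refine abScaledSum_le_typeIBound hr ?_
    have hz' : parabolicCylinder r ((z.1, z.2) : ℝ × EuclideanSpace ℝ (Fin 3)) ⊆
        Iio (0 : ℝ) ×ˢ (univ : Set (EuclideanSpace ℝ (Fin 3))) := hz
    exact parabolicCylinder_subset_lowerHalf_of hr hz' _
  · have key := abScaledSum_conj R r (z.1, R z.2) u p G
    simp only [LinearIsometryEquiv.symm_apply_apply, Prod.mk.eta] at key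
    rw [← key]
    refine abScaledSum_le_typeIBound hr ?_
    have hz' : parabolicCylinder r ((z.1, z.2) : ℝ × EuclideanSpace ℝ (Fin 3)) ⊆
        Iio (0 : ℝ) ×ˢ (univ : Set (EuclideanSpace ℝ (Fin 3))) := hz
    exact parabolicCylinder_subset_lowerHalf_of hr hz' _

/-- **The origin stays singular under rotations**: `‖v‖_{L^∞(Q(0, r))} = ‖u‖_{L^∞(Q(0, r))}`
(`Ψ` preserves `Q(0, r)` and Lebesgue measure, `|R a| = |a|`). -/
theorem isBackwardSingularPoint_zero_conj (h : IsBackwardSingularPoint u 0) :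
    IsBackwardSingularPoint (fun t x => R (u t (R.symm x))) 0 := by
  intro r hr
  set Ψ : ℝ × EuclideanSpace ℝ (Fin 3) → ℝ × EuclideanSpace ℝ (Fin 3) :=
    Prod.map (id : ℝ → ℝ) (R.symm : EuclideanSpace ℝ (Fin 3) → EuclideanSpace ℝ (Fin 3)) with hΨ
  have hΨmp : MeasurePreserving Ψ (volume : Measure (ℝ × EuclideanSpace ℝ (Fin 3))) volume :=
    measurePreserving_prodMap_id_linearIsometryEquiv R.symm
  have hΨemb : MeasurableEmbedding Ψ := measurableEmbedding_prodMap_id_linearIsometryEquiv R.symm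
  set Q₀ : Set (ℝ × EuclideanSpace ℝ (Fin 3)) := parabolicCylinder r 0 with hQ₀
  have hQ : Ψ ⁻¹' Q₀ = Q₀ := by
    have := preimage_prodMap_parabolicCylinder R r (0 : ℝ × EuclideanSpace ℝ (Fin 3))
    simp only [Prod.fst_zero, Prod.snd_zero, map_zero, Prod.mk_zero_zero] at this
    rw [hΨ, hQ₀]
    exact this
  -- `‖R ∘ (u ∘ Ψ)‖_∞ = ‖u ∘ Ψ‖_∞`
  have h1 : eLpNorm (uncurry fun t x => R (u t (R.symm x))) ∞ (volume.restrict Q₀) =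
      eLpNorm (uncurry u ∘ Ψ) ∞ (volume.restrict Q₀) :=
    eLpNorm_congr_norm_ae (ae_of_all _ fun w => by simp [hΨ, uncurry])
  -- `‖u ∘ Ψ‖_{L^∞(Ψ⁻¹ Q)} = ‖u‖_{L^∞(Q)}`
  have h2 : eLpNorm (uncurry u ∘ Ψ) ∞ (volume.restrict Q₀) =
      eLpNorm (uncurry u) ∞ (volume.restrict Q₀) := by
    rw [← hΨemb.eLpNorm_map_measure]
    conv_lhs => rw [← hQ]
    rw [← hΨemb.restrict_map, hΨmp.map_eq]
  rw [h1, h2]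
  exact h r hr

end R3

end LIE

end Summit.NavierStokesRegularity.NavierStokesRegularity.Theorems.RellichScarSimilarityCovariance
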